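import Literature.Geometry.Riemannian.HeatPropagationUpperBound
import Literature.Geometry.Riemannian.RicciFlowHeatKernelFn
import HarnessLib

/-!
# The on-diagonal upper bound `K(x,t;y,s) ≤ C (t − s)^{-m/2}` for the heat kernel of a
# Ricci flow on a closed manifold

R. Bamler, *Entropy and heat kernel bounds on a Ricci flow background*, arXiv:2008.07093 (2020a),
§2.3 / Thm. 7.1 (heat kernel upper bounds): here only the crude, flow-dependent on-diagonal
bound on a compact flow, obtained from the `L¹ → L^∞` bound of the heat propagation
(`IsRicciFlow.exists_heatValue_le`, Nash's argument) and the density property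
`∫ φ dν_{x,t;s} = ∫ φ(y) K(x,t;y,s) dV_s(y) = (P_{s→t}φ)(x)`:

* `IsRicciFlow.exists_heatKernelFn_le` — there is `C ≥ 0` (depending on the flow on `[a, T]`)
  with `K(x,t;y,s) ≤ C (t − s)^{−m/2}` for all `a < s < t ≤ T`, `x, y ∈ M` (`m ≥ 3`).

This is the input for the behaviour of the pointed Nash entropy at the pole (`τ𝒩(τ) → 0`).
Everything is proved; no definitions, no named facts.

## References

* R. H. Bamler, *Entropy and heat kernel bounds on a Ricci flow background*, arXiv:2008.07093
  (2020), §2.3, §7. [Bamler2020Entropy]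
* E. B. Davies, *Heat kernels and spectral theory*, Cambridge Tracts in Math. 92 (1989), §2.4.
-/

noncomputable section

open Bundle Set Function Filter Manifold MeasureTheory Measure TopologicalSpace
open scoped Manifold ContDiff Topology ENNReal NNReal

namespace Literature.Geometry.Riemannian

open Lorentzian Lorentzian.PseudoRiemannianMetric

section KernelUpperBound

variable {m : ℕ} {H : Type*} [TopologicalSpace H]
  {I : ModelWithCorners ℝ (EuclideanSpace ℝ (Fin m)) H} [I.Boundaryless]
  {M : Type*} [TopologicalSpace M] [ChartedSpace H M] [IsManifold I ∞ M]
  [T2Space M] [CompactSpace M] [SecondCountableTopology M] [MeasurableSpace M] [BorelSpace M]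
  [PreconnectedSpace M]
  {g : ℝ → PseudoRiemannianMetric I ∞ (EuclideanSpace ℝ (Fin m)) (TangentSpace I : M → Type _)}
  {cov : ℝ → CovariantDerivative I (EuclideanSpace ℝ (Fin m)) (TangentSpace I : M → Type _)}
  {a T : ℝ} (hflow : IsRicciFlow g cov (Icc a T)) (hh : IsContMDiffFamilyOn ∞ g univ)
  (hR' : ∀ r, (g r).IsRiemannian)

/-- **On-diagonal heat kernel upper bound on a compact Ricci flow**: for a Ricci flow on
`[a, T]`, `a < T`, of a `C^∞` family of Riemannian metrics on a closed connected manifold modelled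
on `ℝᵐ`, `m ≥ 3`, there is `C ≥ 0` with `K(x,t;y,s) ≤ C (t − s)^{−m/2}` for all
`a < s < t ≤ T` and `x, y ∈ M` (`K = heatKernelFn`, the density of `ν_{x,t;s}`; from
`∫ φ K(x,t;·,s) dV_s = (P_{s→t}φ)(x) ≤ C (t−s)^{−m/2} ∫ φ dV_s` for smooth `φ ≥ 0` and the
fundamental lemma). [cite: Bamler2020Entropy, §2.3] -/
theorem IsRicciFlow.exists_heatKernelFn_le (haT : a < T) (hm : 3 ≤ m) :
    ∃ C : ℝ, 0 ≤ C ∧ ∀ t ∈ Ioc a T, ∀ x : M, ∀ s ∈ Ioo a t, ∀ y : M,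
      hflow.heatKernelFn hh hR' t x (y, s) ≤ C * (t - s) ^ (-((m : ℝ) / 2)) := by
  obtain ⟨C, hC, hP⟩ := hflow.exists_heatValue_le hh hR' haT hm
  refine ⟨C, hC, fun t ht x s hs y ↦ ?_⟩
  haveI : IsFiniteMeasure (g s).riemVolume := ⟨(g s).riemVolume_univ_lt_top⟩
  haveI : (g s).riemVolume.IsOpenPosMeasure := by
    rw [riemVolume_eq (hR' s)]; exact isOpenPosMeasure_riemannianMeasure _
  have hKc : Continuous fun y ↦ hflow.heatKernelFn hh hR' t x (y, s) :=
    hflow.continuous_heatKernelFn_slice hh hR' ht x hs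
  refine le_of_forall_integral_mul_contMDiff_le (J := I) ((g s).riemVolume) isOpen_univ
    hKc.continuousOn (fun ζ hζ _ _ hζ0 ↦ ?_) y (mem_univ y)
  -- `∫ K ζ dV_s = ∫ ζ dν_{x,t;s} = (P_{s→t}ζ)(x) ≤ C (t−s)^{−m/2} ∫ ζ dV_s`
  have h1 : ∫ z, hflow.heatKernelFn hh hR' t x (z, s) * ζ z ∂(g s).riemVolume =
      heatValue g s t x ζ := by
    rw [← integral_heatKernelMeasure_eq_heatValue hh hR' hs.2 x hζ,
      hflow.integral_heatKernelMeasure_eq_integral_mul_heatKernelFn hh hR' ht x hs ζ]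
    exact integral_congr_ae (Eventually.of_forall fun z ↦ mul_comm _ _)
  rw [h1]
  exact hP s t hs.1.le hs.2 ht.2 ζ hζ hζ0 x

end KernelUpperBound

end Literature.Geometry.Riemannian

end
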